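import Summits.ValiantsHypothesis.ValiantsHypothesis.Theorems.EquivariantDialLayersApolarKill
import HarnessLib

/-!
# Orbit-sum vanishing for power-sum-free vectors (support for `EquivariantDialLayers`, degree `d ≥ 3`)

Support statements only (lane `--supports`); nothing here closes a route item; the leaf `IdealWidthSuperpoly` is
untouched. File R2a of the «block-witness apolar bound» programme: the scalar identity behind the orbit-sum vanishing
of products of rank-one block forms (file R2b dresses it in `MvPolynomial`).
* §1 One vector `u : α → ℂ` supported in `S` with `∑_x u(x)^k = 0` (`1 ≤ k ≤ D`): for distinct `p₀..p_n ∈ S`, exponents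
  `E_j ≥ 1` with `∑ E_j ≤ D`, `∑_{κ ∈ Sym(S)} ∏_j u(κ p_j)^{E_j} = 0` (`sum_perm_prod_pow_eq_zero`: induction on `n`,
  re-randomising `p₀` over `Sym(S ∖ {p₁..p_n})` — the inner average is a multiple of `∑_{s ∉ {p₁..p_n}} u(κ s)^{E₀} =
  p_{E₀}(u) - ∑_{j ≥ 1} u(κ p_j)^{E₀}`, merging `p₀` into some `p_j`); repeated points `sum_perm_prod_eq_zero`.
* §2 Several vectors, each `= u` or vanishing on `S`, one `= u`: the same sum vanishes over `Sym(S)`, over any finite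
  subgroup `F ⊇ Sym(S)` (cosets), and ★ over the Young subgroup `1 × 𝔖_b ≤ 𝔖_m` (`e : Fin a ⊕ Fin b ≃ Fin m`) under
  INVARIANT hypotheses only (pairwise equal-or-disjoint supports, power-sum free up to `D ≥ #ι`, `a + 1` pairwise
  distinct: pigeonhole + `Equiv.Perm.mem_sumCongrHom_range_of_perm_mapsTo_inl`) — the scalar form of hypothesis `hu`
  of `EquivariantDialLayersApolarKill.boxProd_isotypicProj_eq_zero_of_row`.
-/

set_option linter.dupNamespace false

namespace Summit.ValiantsHypothesis.ValiantsHypothesis.Theorems.EquivariantDialLayersApolarOrbits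

open Equiv (Perm)
open Summit.ValiantsHypothesis.ValiantsHypothesis.Theorems.EquivariantDialLayersApolarKill

section Orbits

variable {α : Type*} [Fintype α] [DecidableEq α]

/-! ## §1 One power-sum-free vector -/

/-- `∑_{τ ∈ Sym(β)} G(τ b) = #Stab(b) • ∑_l G(l)` for any finite `β` (the `Fin m`-typed statement is
`EquivariantDialLayersSymmetrisers.sum_perm_apply_eq_card_smul`). [folklore] -/
theorem sum_perm_apply_eq_card_smul {β M : Type*} [Fintype β] [DecidableEq β] [AddCommMonoid M] (b : β) (G : β → M) :
    ∑ τ : Perm β, G (τ b) = (Finset.univ.filter fun τ : Perm β => τ b = b).card • ∑ l, G l := by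
  classical
  rw [Finset.sum_comp G (fun τ : Perm β => τ b)]
  have himg : Finset.univ.image (fun τ : Perm β => τ b) = Finset.univ := Finset.eq_univ_iff_forall.2 fun l =>
    Finset.mem_image.2 ⟨Equiv.swap b l, Finset.mem_univ _, Equiv.swap_apply_left b l⟩
  rw [himg, Finset.smul_sum]
  refine Finset.sum_congr rfl fun l _ => ?_
  congr 1
  refine Finset.card_bij' (fun τ _ => Equiv.swap b l * τ) (fun τ _ => Equiv.swap b l * τ) ?_ ?_ ?_ ?_
  · exact fun τ hτ => Finset.mem_filter.2
      ⟨Finset.mem_univ _, by rw [Equiv.Perm.mul_apply, (Finset.mem_filter.1 hτ).2, Equiv.swap_apply_right]⟩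
  · exact fun τ hτ => Finset.mem_filter.2
      ⟨Finset.mem_univ _, by rw [Equiv.Perm.mul_apply, (Finset.mem_filter.1 hτ).2, Equiv.swap_apply_left]⟩
  all_goals exact fun τ _ => Equiv.swap_mul_self_mul b l τ

omit [Fintype α] in
/-- A permutation of `S` extended by the identity (`Equiv.Perm.ofSubtype`) does not change a sum over `S`. [folklore] -/
theorem sum_ofSubtype_apply_eq {M : Type*} [AddCommMonoid M] (S : Finset α) (κ : Perm {x // x ∈ S}) (F : α → M) :
    ∑ x ∈ S, F (Perm.ofSubtype κ x) = ∑ x ∈ S, F x := by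
  rw [← Finset.sum_coe_sort S, ← Finset.sum_coe_sort S]
  simp_rw [Perm.ofSubtype_apply_coe]
  exact Equiv.sum_comp κ (fun x : {x // x ∈ S} => F (x : α))

/-- Power sums over `S` after a permutation of `S` are the full power sums (`u` supported in `S`, `k ≥ 1`). [folklore] -/
theorem sum_pow_ofSubtype_apply_eq (S : Finset α) (u : α → ℂ) (hsupp : ∀ x, x ∉ S → u x = 0) (κ : Perm {x // x ∈ S})
    {k : ℕ} (hk : 1 ≤ k) : ∑ x ∈ S, u (Perm.ofSubtype κ x) ^ k = ∑ x, u x ^ k := by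
  rw [sum_ofSubtype_apply_eq S κ (fun x => u x ^ k)]
  exact Finset.sum_subset (Finset.subset_univ S) fun x _ hx => by rw [hsupp x hx, zero_pow (by omega)]

omit [Fintype α] in
/-- Right translation by a permutation moving only points of `S` permutes `Sym(S)`. [folklore] -/
theorem sum_ofSubtype_mul_eq {M : Type*} [AddCommMonoid M] (S : Finset α) (k : Perm α) (hk : ∀ x, k x ≠ x → x ∈ S)
    (F : Perm α → M) : ∑ κ : Perm {x // x ∈ S}, F (Perm.ofSubtype κ * k) = ∑ κ : Perm {x // x ∈ S}, F (Perm.ofSubtype κ) := by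
  have h₁ : ∀ x, k x ∈ S ↔ x ∈ S := fun x => (em (k x = x)).elim (fun hx => by rw [hx]) fun hx =>
    ⟨fun _ => hk x hx, fun _ => hk (k x) fun h => hx (k.injective h)⟩
  have hk₀ : Perm.ofSubtype (k.subtypePerm h₁) = k := Perm.ofSubtype_subtypePerm h₁ hk
  calc ∑ κ : Perm {x // x ∈ S}, F (Perm.ofSubtype κ * k) = ∑ κ : Perm {x // x ∈ S}, F (Perm.ofSubtype (κ * k.subtypePerm h₁)) := by
        simp_rw [map_mul, hk₀]
    _ = ∑ κ : Perm {x // x ∈ S}, F (Perm.ofSubtype κ) := Fintype.sum_bijective (· * k.subtypePerm h₁) (Group.mulRight_bijective _)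
        (fun κ => F (Perm.ofSubtype (κ * k.subtypePerm h₁))) (fun κ => F (Perm.ofSubtype κ)) fun _ => rfl

/-- Reduction step: re-randomising `p₀` over `Sym(S ∖ {p₁..p_n})` writes `N • ∑_{κ ∈ Sym(S)} ∏_j u(κ p_j)^{E_j}` (`N > 0`)
as `-c •` the sum over `j' ≥ 1` of the same sums for the points `p₁..p_n` with `E₀` merged into `E_{j'}`. [folklore] -/
theorem card_smul_sum_perm_prod_pow_eq (S : Finset α) (u : α → ℂ) (hsupp : ∀ x, x ∉ S → u x = 0) {D : ℕ}
    (hpow : ∀ k : ℕ, 1 ≤ k → k ≤ D → ∑ x, u x ^ k = 0) {n : ℕ} (pts : Fin (n + 1) ↪ α) (hpts : ∀ j, pts j ∈ S)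
    (E : Fin (n + 1) → ℕ) (hE0 : 1 ≤ E 0) (hE0D : E 0 ≤ D) :
    ∃ N c : ℕ, 0 < N ∧ N • ∑ κ : Perm {x // x ∈ S}, ∏ j, u (Perm.ofSubtype κ (pts j)) ^ E j =
      -(c • ∑ j' : Fin n, ∑ κ : Perm {x // x ∈ S},
          ∏ j : Fin n, u (Perm.ofSubtype κ (pts j.succ)) ^ (E j.succ + if j = j' then E 0 else 0)) := by
  classical
  obtain ⟨I, hI⟩ : ∃ I : Finset α, I = Finset.univ.image fun j : Fin n => pts j.succ := ⟨_, rfl⟩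
  have hsumI : ∀ f : α → ℂ, ∑ x ∈ I, f x = ∑ j : Fin n, f (pts j.succ) := fun f => by
    rw [hI, Finset.sum_image fun j _ j' _ h => Fin.succ_injective _ (pts.injective h)]
  have hmemI : ∀ x, x ∈ I ↔ ∃ j : Fin n, pts j.succ = x := fun x => by rw [hI]; simp [Finset.mem_image]
  have hIS : I ⊆ S := fun x hx => by obtain ⟨j, rfl⟩ := (hmemI x).1 hx; exact hpts _
  have ha' : pts 0 ∈ S \ I := Finset.mem_sdiff.2 ⟨hpts 0, fun h => by
    obtain ⟨j, hj⟩ := (hmemI _).1 h; exact Fin.succ_ne_zero j (pts.injective hj)⟩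
  have hsucc : ∀ j : Fin n, pts j.succ ∉ S \ I := fun j h => (Finset.mem_sdiff.1 h).2 ((hmemI _).2 ⟨j, rfl⟩)
  have hmove : ∀ κ' : Perm {x // x ∈ S \ I}, ∀ x, Perm.ofSubtype κ' x ≠ x → x ∈ S := fun κ' x hx =>
    Classical.byContradiction fun hxS => hx (Perm.ofSubtype_apply_of_not_mem κ' fun h => hxS (Finset.sdiff_subset h))
  obtain ⟨c, hc⟩ : ∃ c : ℕ, ∀ G : {x // x ∈ S \ I} → ℂ, ∑ τ : Perm {x // x ∈ S \ I}, G (τ ⟨pts 0, ha'⟩) = c • ∑ l, G l :=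
    ⟨_, fun G => sum_perm_apply_eq_card_smul _ G⟩
  refine ⟨Fintype.card (Perm {x // x ∈ S \ I}), c, Fintype.card_pos, ?_⟩
  have step1 : Fintype.card (Perm {x // x ∈ S \ I}) • ∑ κ : Perm {x // x ∈ S}, ∏ j, u (Perm.ofSubtype κ (pts j)) ^ E j =
      ∑ κ' : Perm {x // x ∈ S \ I}, ∑ κ : Perm {x // x ∈ S}, ∏ j, u ((Perm.ofSubtype κ * Perm.ofSubtype κ') (pts j)) ^ E j := by
    rw [← Finset.card_univ, ← Finset.sum_const]
    exact Finset.sum_congr rfl fun κ' _ =>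
      (sum_ofSubtype_mul_eq S (Perm.ofSubtype κ') (hmove κ') fun k => ∏ j, u (k (pts j)) ^ E j).symm
  have step2 : ∀ κ : Perm {x // x ∈ S}, ∑ κ' : Perm {x // x ∈ S \ I}, ∏ j, u ((Perm.ofSubtype κ * Perm.ofSubtype κ') (pts j)) ^ E j =
      -(c • ∑ j' : Fin n, ∏ j : Fin n, u (Perm.ofSubtype κ (pts j.succ)) ^ (E j.succ + if j = j' then E 0 else 0)) := by
    intro κ
    have hfac : ∀ κ' : Perm {x // x ∈ S \ I}, ∏ j, u ((Perm.ofSubtype κ * Perm.ofSubtype κ') (pts j)) ^ E j =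
        u (Perm.ofSubtype κ ((κ' ⟨pts 0, ha'⟩ : {x // x ∈ S \ I}) : α)) ^ E 0 *
          ∏ j : Fin n, u (Perm.ofSubtype κ (pts j.succ)) ^ E j.succ := fun κ' => by
      rw [Fin.prod_univ_succ, Perm.mul_apply, Perm.ofSubtype_apply_of_mem κ' ha']
      exact congrArg _ (Finset.prod_congr rfl fun j _ => by rw [Perm.mul_apply, Perm.ofSubtype_apply_of_not_mem κ' (hsucc j)])
    have hS' : ∑ l : {x // x ∈ S \ I}, u (Perm.ofSubtype κ l) ^ E 0 = -∑ j : Fin n, u (Perm.ofSubtype κ (pts j.succ)) ^ E 0 := by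
      rw [Finset.sum_coe_sort (S \ I) (fun s => u (Perm.ofSubtype κ s) ^ E 0)]
      have h1 := Finset.sum_sdiff hIS (f := fun s => u (Perm.ofSubtype κ s) ^ E 0)
      rw [sum_pow_ofSubtype_apply_eq S u hsupp κ hE0, hpow (E 0) hE0 hE0D, hsumI] at h1
      linear_combination h1
    simp_rw [hfac]
    rw [← Finset.sum_mul, hc (fun s => u (Perm.ofSubtype κ s) ^ E 0), hS', smul_neg, neg_mul, Finset.smul_sum, Finset.sum_mul,
      Finset.smul_sum]
    refine congrArg _ (Finset.sum_congr rfl fun j' _ => ?_)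
    rw [smul_mul_assoc, mul_comm, show (∏ j : Fin n, u (Perm.ofSubtype κ (pts j.succ)) ^ (E j.succ + if j = j' then E 0 else 0))
        = ∏ j : Fin n, (u (Perm.ofSubtype κ (pts j.succ)) ^ E j.succ * u (Perm.ofSubtype κ (pts j.succ)) ^ (if j = j' then E 0 else 0))
        from Finset.prod_congr rfl fun j _ => pow_add _ _ _, Finset.prod_mul_distrib]
    refine congrArg _ (congrArg _ ?_)
    simp_rw [pow_ite, pow_zero]
    simp [Finset.prod_ite_eq']
  rw [step1, Finset.sum_comm, Finset.sum_congr rfl fun κ _ => step2 κ, Finset.sum_neg_distrib, ← Finset.smul_sum,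
    Finset.sum_comm]

/-- ★ SINGLE-VECTOR LEMMA: `u` supported in `S` with `∑_x u(x)^k = 0` for `1 ≤ k ≤ D`; distinct points `p₀, …, p_n ∈ S`;
exponents `E_j ≥ 1` with `∑ E_j ≤ D`. Then `∑_{κ ∈ Sym(S)} ∏_j u(κ p_j)^{E_j} = 0`. [folklore] -/
theorem sum_perm_prod_pow_eq_zero (S : Finset α) (u : α → ℂ) (hsupp : ∀ x, x ∉ S → u x = 0) {D : ℕ}
    (hpow : ∀ k : ℕ, 1 ≤ k → k ≤ D → ∑ x, u x ^ k = 0) (n : ℕ) :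
    ∀ (pts : Fin (n + 1) ↪ α) (_ : ∀ j, pts j ∈ S) (E : Fin (n + 1) → ℕ) (_ : ∀ j, 1 ≤ E j) (_ : ∑ j, E j ≤ D),
      ∑ κ : Perm {x // x ∈ S}, ∏ j, u (Perm.ofSubtype κ (pts j)) ^ E j = 0 := by
  induction n with
  | zero => ?_
  | succ n ih => ?_
  all_goals
    intro pts hpts E hE hED
    obtain ⟨N, c, hN, h⟩ := card_smul_sum_perm_prod_pow_eq S u hsupp hpow pts hpts E (hE 0)
      ((Finset.single_le_sum (fun j _ => Nat.zero_le (E j)) (Finset.mem_univ 0)).trans hED)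
    refine (smul_eq_zero.1 (h.trans (neg_eq_zero.2 (smul_eq_zero_of_right c (Finset.sum_eq_zero fun j' _ => ?_))))).resolve_left
      hN.ne'
  · exact j'.elim0
  · have hsum : ∑ j : Fin (n + 1), (E j.succ + if j = j' then E 0 else 0) ≤ D := by
      rw [Finset.sum_add_distrib, Finset.sum_ite_eq' Finset.univ j' (fun _ => E 0), if_pos (Finset.mem_univ _)]
      rw [Fin.sum_univ_succ] at hED
      omega
    exact ih ((Fin.succEmb (n + 1)).trans pts) (fun j => hpts j.succ) (fun j => E j.succ + if j = j' then E 0 else 0)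
      (fun j => (hE _).trans (Nat.le_add_right _ _)) hsum

/-- Repeated points: `∑_{κ ∈ Sym(S)} ∏_{i ∈ ι} u(κ pᵢ) = 0` for any `1 ≤ #ι ≤ D` points `pᵢ`. [folklore] -/
theorem sum_perm_prod_eq_zero (S : Finset α) (u : α → ℂ) (hsupp : ∀ x, x ∉ S → u x = 0) {D : ℕ}
    (hpow : ∀ k : ℕ, 1 ≤ k → k ≤ D → ∑ x, u x ^ k = 0) {ι : Type*} [Fintype ι] [Nonempty ι] (hD : Fintype.card ι ≤ D)
    (pt : ι → α) : ∑ κ : Perm {x // x ∈ S}, ∏ i, u (Perm.ofSubtype κ (pt i)) = 0 := by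
  classical
  by_cases hout : ∃ i, pt i ∉ S
  · obtain ⟨i, hi⟩ := hout
    exact Finset.sum_eq_zero fun κ _ => Finset.prod_eq_zero (Finset.mem_univ i) (by
      rw [Perm.ofSubtype_apply_of_not_mem κ hi, hsupp _ hi])
  push Not at hout
  obtain ⟨P, hP⟩ : ∃ P : Finset α, P = Finset.univ.image pt := ⟨_, rfl⟩
  obtain ⟨n, hn⟩ : ∃ n, P.card = n + 1 :=
    Nat.exists_eq_succ_of_ne_zero (Finset.card_pos.2 (by rw [hP]; exact Finset.univ_nonempty.image pt)).ne'
  have θ : Fin (n + 1) ≃ {x // x ∈ P} := (Fintype.equivFinOfCardEq (by rw [Fintype.card_coe, hn])).symm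
  have hmemP : ∀ j, ∃ i, pt i = (θ j : α) := fun j => by simpa [hP] using (θ j).2
  have hreS : ∑ b ∈ P, (Finset.univ.filter fun i => pt i = b).card = ∑ j, (Finset.univ.filter fun i => pt i = (θ j : α)).card := by
    rw [← Finset.sum_coe_sort P]
    exact (Equiv.sum_comp θ fun b : {x // x ∈ P} => (Finset.univ.filter fun i => pt i = (b : α)).card).symm
  have hED : ∑ j, (Finset.univ.filter fun i => pt i = (θ j : α)).card ≤ D := by
    rw [← hreS, hP, ← Finset.card_eq_sum_card_image, Finset.card_univ]
    exact hD
  calc ∑ κ : Perm {x // x ∈ S}, ∏ i, u (Perm.ofSubtype κ (pt i))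
      = ∑ κ : Perm {x // x ∈ S}, ∏ j, u (Perm.ofSubtype κ (θ j)) ^ (Finset.univ.filter fun i => pt i = (θ j : α)).card := by
        refine Finset.sum_congr rfl fun κ _ => ?_
        rw [Finset.prod_comp (s := (Finset.univ : Finset ι)) (fun x => u (Perm.ofSubtype κ x)) pt, ← hP, ← Finset.prod_coe_sort P]
        exact (Equiv.prod_comp θ fun b : {x // x ∈ P} =>
          u (Perm.ofSubtype κ b) ^ (Finset.univ.filter fun i => pt i = (b : α)).card).symm
    _ = 0 := sum_perm_prod_pow_eq_zero S u hsupp hpow n (θ.toEmbedding.trans (Function.Embedding.subtype _))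
        (fun j => show (θ j : α) ∈ S by obtain ⟨i, hi⟩ := hmemP j; exact hi ▸ hout i) _
        (fun j => by obtain ⟨i, hi⟩ := hmemP j; exact Finset.card_pos.2 ⟨i, Finset.mem_filter.2 ⟨Finset.mem_univ _, hi⟩⟩) hED

/-! ## §2 Several vectors -/

omit [Fintype α] in
/-- A vector vanishing on `S` is unchanged by `Sym(S)`. [folklore] -/
theorem apply_ofSubtype_eq_of_forall_mem (S : Finset α) {w : α → ℂ} (hw : ∀ x ∈ S, w x = 0) (κ : Perm {x // x ∈ S})
    (x : α) : w (Perm.ofSubtype κ x) = w x := by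
  by_cases hx : x ∈ S
  · rw [Perm.ofSubtype_apply_of_mem κ hx, hw x hx, hw _ (κ ⟨x, hx⟩).2]
  · rw [Perm.ofSubtype_apply_of_not_mem κ hx]

/-- Several vectors, each `= u` or vanishing on `S`, one of them `= u`: `∑_{κ ∈ Sym(S)} ∏_i v_i(κ pᵢ) = 0`. [folklore] -/
theorem sum_perm_prod_family_eq_zero (S : Finset α) (u : α → ℂ) (hsupp : ∀ x, x ∉ S → u x = 0) {D : ℕ}
    (hpow : ∀ k : ℕ, 1 ≤ k → k ≤ D → ∑ x, u x ^ k = 0) {ι : Type*} [Fintype ι] (v : ι → α → ℂ)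
    (hv : ∀ i, v i = u ∨ ∀ x ∈ S, v i x = 0) (hi₀ : ∃ i, v i = u) (hD : Fintype.card ι ≤ D) (pt : ι → α) :
    ∑ κ : Perm {x // x ∈ S}, ∏ i, v i (Perm.ofSubtype κ (pt i)) = 0 := by
  classical
  obtain ⟨i₀, hi₀⟩ := hi₀
  obtain ⟨A, hA⟩ : ∃ A : Finset ι, A = Finset.univ.filter fun i => v i = u := ⟨_, rfl⟩
  have hmemA : ∀ i, i ∈ A ↔ v i = u := fun i => by rw [hA, Finset.mem_filter]; simp
  have hsplit : ∀ κ : Perm {x // x ∈ S}, ∏ i, v i (Perm.ofSubtype κ (pt i)) =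
      (∏ i : {i // i ∈ A}, u (Perm.ofSubtype κ (pt i))) * ∏ i ∈ Finset.univ.filter (fun i => ¬v i = u), v i (pt i) := by
    intro κ
    rw [← Finset.prod_filter_mul_prod_filter_not Finset.univ (fun i => v i = u), ← hA, ← Finset.prod_coe_sort A]
    exact congrArg₂ _ (Finset.prod_congr rfl fun i _ => by rw [(hmemA i).1 i.2]) (Finset.prod_congr rfl fun i hi =>
      apply_ofSubtype_eq_of_forall_mem S ((hv i).resolve_left (Finset.mem_filter.1 hi).2) κ (pt i))
  haveI : Nonempty {i // i ∈ A} := ⟨⟨i₀, (hmemA i₀).2 hi₀⟩⟩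
  simp_rw [hsplit]
  rw [← Finset.sum_mul, sum_perm_prod_eq_zero S u hsupp hpow ((Fintype.card_coe A).trans_le ((Finset.card_le_univ A).trans hD))
    (fun i : {i // i ∈ A} => pt i), zero_mul]

/-- Coset averaging: for any finite subgroup `F ⊇ Sym(S)` of `Sym(α)`, `∑_{h ∈ F} ∏_i v_i(h⁻¹ pᵢ) = 0` (hypotheses of
`sum_perm_prod_family_eq_zero`). [folklore] -/
theorem sum_subgroup_prod_family_eq_zero (S : Finset α) (u : α → ℂ) (hsupp : ∀ x, x ∉ S → u x = 0) {D : ℕ}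
    (hpow : ∀ k : ℕ, 1 ≤ k → k ≤ D → ∑ x, u x ^ k = 0) {ι : Type*} [Fintype ι] (v : ι → α → ℂ)
    (hv : ∀ i, v i = u ∨ ∀ x ∈ S, v i x = 0) (hi₀ : ∃ i, v i = u) (hD : Fintype.card ι ≤ D) (pt : ι → α)
    (F : Subgroup (Perm α)) [Fintype F] (hF : ∀ κ : Perm {x // x ∈ S}, Perm.ofSubtype κ ∈ F) :
    ∑ h : F, ∏ i, v i (((h : F) : Perm α)⁻¹ (pt i)) = 0 := by
  classical
  have hN : Fintype.card (Perm {x // x ∈ S}) • ∑ h : F, ∏ i, v i (((h : F) : Perm α)⁻¹ (pt i)) = 0 := by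
    rw [← Finset.card_univ, ← Finset.sum_const]
    calc ∑ _κ : Perm {x // x ∈ S}, ∑ h : F, ∏ i, v i (((h : F) : Perm α)⁻¹ (pt i))
        = ∑ κ : Perm {x // x ∈ S}, ∑ h : F, ∏ i, v i (((h * ⟨Perm.ofSubtype κ, hF κ⟩ : F) : Perm α)⁻¹ (pt i)) :=
          Finset.sum_congr rfl fun κ _ => (Fintype.sum_bijective (· * (⟨Perm.ofSubtype κ, hF κ⟩ : F)) (Group.mulRight_bijective _)
            (fun h => ∏ i, v i (((h * ⟨Perm.ofSubtype κ, hF κ⟩ : F) : Perm α)⁻¹ (pt i)))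
            (fun h => ∏ i, v i (((h : F) : Perm α)⁻¹ (pt i))) fun _ => rfl).symm
      _ = ∑ h : F, ∑ κ : Perm {x // x ∈ S}, ∏ i, v i (Perm.ofSubtype κ⁻¹ (((h : F) : Perm α)⁻¹ (pt i))) := by
          rw [Finset.sum_comm]
          refine Finset.sum_congr rfl fun h _ => Finset.sum_congr rfl fun κ _ => Finset.prod_congr rfl fun i _ => ?_
          rw [Subgroup.coe_mul, mul_inv_rev, Perm.mul_apply, map_inv]
      _ = ∑ h : F, ∑ κ : Perm {x // x ∈ S}, ∏ i, v i (Perm.ofSubtype κ (((h : F) : Perm α)⁻¹ (pt i))) :=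
          Finset.sum_congr rfl fun h _ => Fintype.sum_equiv (Equiv.inv (Perm {x // x ∈ S}))
            (fun κ => ∏ i, v i (Perm.ofSubtype κ⁻¹ (((h : F) : Perm α)⁻¹ (pt i))))
            (fun κ => ∏ i, v i (Perm.ofSubtype κ (((h : F) : Perm α)⁻¹ (pt i)))) fun _ => rfl
      _ = 0 := Finset.sum_eq_zero fun h _ => sum_perm_prod_family_eq_zero S u hsupp hpow v hv hi₀ hD _
  exact (smul_eq_zero.1 hN).resolve_left Fintype.card_ne_zero

/-- Pigeonhole: of `a + 1` pairwise distinct, disjointly supported vectors one vanishes at any `a` points. [folklore] -/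
theorem exists_forall_rep_apply_eq_zero {ι : Type*} {m a : ℕ} (v : ι → Fin m → ℂ)
    (hH1 : ∀ i j, v i = v j ∨ ∀ x, v i x = 0 ∨ v j x = 0) (rep : Fin (a + 1) → ι)
    (hrep : Function.Injective fun j => v (rep j)) (row : Fin a → Fin m) :
    ∃ j₀, ∀ t, v (rep j₀) (row t) = 0 := by
  by_contra h
  push Not at h
  choose t ht using h
  have hinj : Function.Injective t := by
    intro j j' hjj'
    apply hrep
    rcases hH1 (rep j) (rep j') with h | h
    · exact h
    · exact absurd ((h (row (t j))).resolve_left (ht j)) (hjj' ▸ ht j')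
  have := Fintype.card_le_of_injective t hinj
  simp [Fintype.card_fin] at this

/-- ★ SCALAR ORBIT-SUM VANISHING over the Young subgroup `1 × 𝔖_b ≤ 𝔖_m` (`e : Fin a ⊕ Fin b ≃ Fin m`), INVARIANT
hypotheses only (`v_i` pairwise equal or disjointly supported, power-sum free up to `D ≥ #ι`, `a + 1` of them pairwise
distinct): `∑_{ρ' ∈ 𝔖_b} ∏_i v_i((1 × ρ')⁻¹ pᵢ) = 0` for ALL points `pᵢ`. [folklore] -/
theorem sum_perm_prod_sumCongr_eq_zero {ι : Type*} [Fintype ι] {m a b D : ℕ} (e : Fin a ⊕ Fin b ≃ Fin m)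
    (v : ι → Fin m → ℂ) (hH1 : ∀ i j, v i = v j ∨ ∀ x, v i x = 0 ∨ v j x = 0)
    (hH2 : ∀ i (k : ℕ), 1 ≤ k → k ≤ D → ∑ x, v i x ^ k = 0) (hD : Fintype.card ι ≤ D)
    (rep : Fin (a + 1) → ι) (hrep : Function.Injective fun j => v (rep j)) (pt : ι → Fin m) :
    ∑ ρ' : Perm (Fin b), ∏ i, v i ((e.permCongr ((1 : Perm (Fin a)).sumCongr ρ'))⁻¹ (pt i)) = 0 := by
  classical
  obtain ⟨j₀, hj₀⟩ := exists_forall_rep_apply_eq_zero v hH1 rep hrep fun t => e (Sum.inl t)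
  obtain ⟨ψ, hψ, hψe⟩ := exists_monoidHom_sumCongr e
  obtain ⟨S, hS⟩ : ∃ S : Finset (Fin m), S = Finset.univ.filter fun x => v (rep j₀) x ≠ 0 := ⟨_, rfl⟩
  have hmemS : ∀ x, x ∈ S ↔ v (rep j₀) x ≠ 0 := fun x => by rw [hS]; simp
  have hsupp : ∀ x, x ∉ S → v (rep j₀) x = 0 := fun x hx => by simpa [hmemS] using hx
  have hv : ∀ i, v i = v (rep j₀) ∨ ∀ x ∈ S, v i x = 0 := fun i =>
    (hH1 i (rep j₀)).imp_right fun h x hx => (h x).resolve_right ((hmemS x).1 hx)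
  have hF : ∀ κ : Perm {x // x ∈ S}, Perm.ofSubtype κ ∈ ψ.range := by
    intro κ
    have hfix : ∀ t : Fin a, Perm.ofSubtype κ (e (Sum.inl t)) = e (Sum.inl t) := fun t =>
      Perm.ofSubtype_apply_of_not_mem κ fun h => (hmemS _).1 h (hj₀ t)
    have hmaps : Set.MapsTo (e.symm.permCongr (Perm.ofSubtype κ)) (Set.range Sum.inl) (Set.range Sum.inl) := by
      rintro _ ⟨t, rfl⟩
      exact ⟨t, by rw [Equiv.permCongr_apply, Equiv.symm_symm, hfix, Equiv.symm_apply_apply]⟩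
    obtain ⟨⟨σ₁, σ₂⟩, hσ⟩ := MonoidHom.mem_range.1 (Perm.mem_sumCongrHom_range_of_perm_mapsTo_inl hmaps)
    simp only [Perm.sumCongrHom_apply] at hσ
    have hσ₁ : σ₁ = 1 := Equiv.ext fun t => by
      have h := congrArg (fun π : Perm (Fin a ⊕ Fin b) => π (Sum.inl t)) hσ
      simp only [Perm.sumCongr_apply, Sum.map_inl, Equiv.permCongr_apply, Equiv.symm_symm, hfix, Equiv.symm_apply_apply] at h
      exact (Sum.inl_injective h).trans (Perm.one_apply t).symm
    refine MonoidHom.mem_range.2 ⟨σ₂, ?_⟩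
    rw [hψe, ← hσ₁, hσ]
    ext x
    simp [Equiv.permCongr_apply]
  exact (Fintype.sum_equiv (MonoidHom.ofInjective hψ).toEquiv _ _ fun ρ' => by simp [MonoidHom.ofInjective_apply, hψe]).trans
    (sum_subgroup_prod_family_eq_zero S (v (rep j₀)) hsupp (hH2 (rep j₀)) v hv ⟨rep j₀, rfl⟩ hD pt ψ.range hF)

end Orbits

end Summit.ValiantsHypothesis.ValiantsHypothesis.Theorems.EquivariantDialLayersApolarOrbits
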